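import Literature.MathematicalPhysics.QuantumLattice.HubbardGridCounterQuadraticMatrix
import Literature.MathematicalPhysics.QuantumLattice.HubbardCovarianceFrameResolvent
import Literature.MathematicalPhysics.QuantumLattice.GrassmannGaussianQuadraticInsertion
import Literature.MathematicalPhysics.QuantumLattice.GrassmannLinearSubstitution
import HarnessLib

/-!
# Transport of quadratic insertions along a linear field substitution: `map_T (Σ A ψψ) = Σ (T A Tᵀ) ψ̂ψ̂`, uniqueness of the
# antisymmetric matrix of a quadratic element, and the grid-to-torus transport of the counterterm matrix `T S_g Tᵀ = S_K`

Topic `MathematicalPhysics/QuantumLattice`; sequel of `HubbardGridCounterQuadraticMatrix` (the matrix `N_g` of the grid counterterm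
`𝒩_{K,N}`), `HubbardGridCounterQuadratic` (`map (toLin' S_N) 𝒩_{K,N} = 𝒩_K`, Benfatto–Giuliani–Mastropietro 2003 §1.2 (2.10)) and
`HubbardCovarianceFrameResolvent` (`−𝒩_K = Σ N_K(X,Y) ψ̂(X)ψ̂(Y)`, the counterterm as a resolvent of the covariance).  The K-resummed
representation of the counterterm frame dresses the torus covariance `C` by `M`, `M(1 + C S_K) = 1`, `S_K = N_K − N_Kᵀ`; the decay
estimates run on the grid, where the pulled-back covariance `Sᵀ C S` is dressed by `S_g = N_g − N_gᵀ`.  The two are intertwined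
(`WeightedRowSumResolvent.transpose_mul_resolvent_mul_mul`) as soon as `S_K = S·S_g·Sᵀ`, which is what this file proves:

* `map_sum_sum_smul_gen_mul_gen` — a linear substitution `ψ(Y) ↦ Σ_X T(X,Y) ψ̂(X)` maps `Σ_{Y,Y'} A(Y,Y') ψ(Y)ψ(Y')` to
  `Σ_{X,X'} (T A Tᵀ)(X,X') ψ̂(X)ψ̂(X')`;
* `sub_eq_sub_of_sum_sum_smul_eq` — the ANTISYMMETRIC part of the matrix of a quadratic element is determined by the element:
  `Σ A ψψ = Σ B ψψ ⇒ A(Z,W) − A(W,Z) = B(Z,W) − B(W,Z)` (two Grassmann derivatives and the constant part);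
* **`hubbardGridSub_mul_anti_mul_transpose`** — for ANY matrix `N_g` with `−𝒩_{K,N} = Σ N_g ψψ` (e.g. `−gridCounterMatrix`,
  `hubbardGridSub_mul_gridCounterAnti_mul_transpose`), `S_N (N_g − N_gᵀ) S_Nᵀ = N_K − N_Kᵀ` with `N_K` the torus matrix of
  `neg_counterQuadratic_eq_sum` (`2M ≤ N`, `β ≠ 0`).

Everything is proved; no definitions, no named facts.

## Sources

G. Benfatto, A. Giuliani, V. Mastropietro, Ann. Henri Poincaré 4 (2003) 137–193, §1.2 (2.9)–(2.10) [`BenfattoGiulianiMastropietro2003`];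
M. Salmhofer, *Renormalization* (1999), App. B.2 (B.23)–(B.25) (linear substitutions in Grassmann integrals) [`Salmhofer1999`].
-/

noncomputable section

namespace Literature.MathematicalPhysics.QuantumLattice

open GrassmannAlgebra Finset Literature.Probability.LatticeModels
open scoped Matrix

/-! ### Quadratic elements under a linear substitution -/

section Generic

variable {R : Type*} [CommRing R] {Γ Γ' : Type*} [Fintype Γ] [DecidableEq Γ] [Fintype Γ'] [DecidableEq Γ']

/-- **A linear substitution transports a quadratic insertion by congruence**: with `T = toMatrix' f` (so `map f ψ(Y) = Σ_X T(X,Y) ψ̂(X)`,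
`map_gen_eq_sum`), `map f (Σ_{Y,Y'} A(Y,Y') ψ(Y)ψ(Y')) = Σ_{X,X'} (T·A·Tᵀ)(X,X') ψ̂(X)ψ̂(X')` (Salmhofer 1999, (B.23)–(B.25): a quadratic
form pulls back along the substitution). [cite: Salmhofer1999, App. B.2 (B.23)-(B.25)] -/
theorem map_sum_sum_smul_gen_mul_gen (f : (Γ → R) →ₗ[R] (Γ' → R)) (A : Matrix Γ Γ R) :
    ExteriorAlgebra.map f (∑ Y, ∑ Y', A Y Y' • (gen R Y * gen R Y')) =
      ∑ X, ∑ X', (LinearMap.toMatrix' f * A * (LinearMap.toMatrix' f)ᵀ) X X' • (gen R X * gen R X') := by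
  set T := LinearMap.toMatrix' f with hT
  have hL : ∀ Y Y', ExteriorAlgebra.map f (gen R Y * gen R Y') = ∑ X, ∑ X', (T X Y * T X' Y') • (gen R X * gen R X') := by
    intro Y Y'
    rw [map_mul, map_gen_eq_sum, map_gen_eq_sum, Finset.sum_mul]
    refine Finset.sum_congr rfl fun X _ => ?_
    rw [Finset.mul_sum]
    refine Finset.sum_congr rfl fun X' _ => ?_
    rw [smul_mul_smul_comm]
  have hL' : ∀ Y Y', ExteriorAlgebra.map f (A Y Y' • (gen R Y * gen R Y')) =
      ∑ X, ∑ X', (A Y Y' * (T X Y * T X' Y')) • (gen R X * gen R X') := by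
    intro Y Y'
    rw [map_smul, hL, Finset.smul_sum]
    refine Finset.sum_congr rfl fun X _ => ?_
    rw [Finset.smul_sum]
    exact Finset.sum_congr rfl fun X' _ => by rw [smul_smul]
  calc ExteriorAlgebra.map f (∑ Y, ∑ Y', A Y Y' • (gen R Y * gen R Y'))
      = ∑ Y, ∑ Y', ExteriorAlgebra.map f (A Y Y' • (gen R Y * gen R Y')) := by
        rw [map_sum]
        exact Finset.sum_congr rfl fun Y _ => map_sum _ _ _
    _ = ∑ Y, ∑ Y', ∑ X, ∑ X', (A Y Y' * (T X Y * T X' Y')) • (gen R X * gen R X') :=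
        Finset.sum_congr rfl fun Y _ => Finset.sum_congr rfl fun Y' _ => hL' Y Y'
    _ = ∑ X, ∑ X', ∑ Y, ∑ Y', (A Y Y' * (T X Y * T X' Y')) • (gen R X * gen R X') := sum_sum_sum_sum_comm _
    _ = ∑ X, ∑ X', (T * A * Tᵀ) X X' • (gen R X * gen R X') := by
        refine Finset.sum_congr rfl fun X _ => Finset.sum_congr rfl fun X' _ => ?_
        simp_rw [← Finset.sum_smul]
        congr 1
        simp_rw [Matrix.mul_apply, Matrix.transpose_apply, Finset.sum_mul]
        rw [Finset.sum_comm]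
        exact Finset.sum_congr rfl fun Y' _ => Finset.sum_congr rfl fun Y _ => by ring

/-- The constant part of `∂_W Σ_Y c(Y) ψ(Y)` is `c(W)`. [cite: BenfattoGiulianiMastropietro2003, §1.2 The model (2.10)] -/
theorem constPart_grassmannDeriv_sum_smul_gen (c : Γ → R) (W : Γ) :
    constPart R (grassmannDeriv R W (∑ Y, c Y • gen R Y)) = c W := by
  have h1 : constPart R (1 : GrassmannAlgebra R Γ) = 1 := by
    have h := constPart_algebraMap R (Γ := Γ) 1
    rwa [map_one] at h
  have h2 : ∀ Y, grassmannDeriv R W (c Y • gen R Y) = if W = Y then c Y • (1 : GrassmannAlgebra R Γ) else 0 := by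
    intro Y
    rw [map_smul, grassmannDeriv_gen]
    split_ifs with h
    · rfl
    · rw [smul_zero]
  rw [map_sum]
  simp_rw [h2]
  rw [Finset.sum_ite_eq, if_pos (Finset.mem_univ _), map_smul, h1, smul_eq_mul, mul_one]

/-- **The antisymmetric part of the matrix of a quadratic element is intrinsic**: if `Σ_{X,Y} A(X,Y) ψ(X)ψ(Y) = Σ_{X,Y} B(X,Y) ψ(X)ψ(Y)`
then `A(Z,W) − A(W,Z) = B(Z,W) − B(W,Z)` for all `Z, W` (`∂_Z` of the element is `Σ_Y (N(Z,Y) − N(Y,Z)) ψ(Y)`,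
`grassmannDeriv_of_eq_quadratic`; then `∂_W` and the constant part) — only `S = N − Nᵀ` enters the resolvent `M(1 + CS) = 1`.
[cite: BenfattoGiulianiMastropietro2003, §1.2 The model (2.10)] -/
theorem sub_eq_sub_of_sum_sum_smul_eq {A B : Matrix Γ Γ R}
    (h : ∑ X, ∑ Y, A X Y • (gen R X * gen R Y) = ∑ X, ∑ Y, B X Y • (gen R X * gen R Y)) (Z W : Γ) :
    A Z W - A W Z = B Z W - B W Z := by
  have hA := grassmannDeriv_of_eq_quadratic A (q := ∑ X, ∑ Y, A X Y • (gen R X * gen R Y)) rfl Z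
  have hB := grassmannDeriv_of_eq_quadratic B (q := ∑ X, ∑ Y, A X Y • (gen R X * gen R Y)) h Z
  have hA' : constPart R (grassmannDeriv R W (grassmannDeriv R Z (∑ X, ∑ Y, A X Y • (gen R X * gen R Y)))) = A Z W - A W Z := by
    rw [hA]
    exact constPart_grassmannDeriv_sum_smul_gen (fun Y => A Z Y - A Y Z) W
  have hB' : constPart R (grassmannDeriv R W (grassmannDeriv R Z (∑ X, ∑ Y, A X Y • (gen R X * gen R Y)))) = B Z W - B W Z := by
    rw [hB]
    exact constPart_grassmannDeriv_sum_smul_gen (fun Y => B Z Y - B Y Z) W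
  exact hA'.symm.trans hB'

/-- **Matrix form**: under the hypothesis of `sub_eq_sub_of_sum_sum_smul_eq`, `of (A(X,Y) − A(Y,X)) = of (B(X,Y) − B(Y,X))`.
[cite: BenfattoGiulianiMastropietro2003, §1.2 The model (2.10)] -/
theorem anti_eq_anti_of_sum_sum_smul_eq {A B : Matrix Γ Γ R}
    (h : ∑ X, ∑ Y, A X Y • (gen R X * gen R Y) = ∑ X, ∑ Y, B X Y • (gen R X * gen R Y)) :
    (Matrix.of fun X Y => A X Y - A Y X) = Matrix.of fun X Y => B X Y - B Y X := by
  ext Z W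
  rw [Matrix.of_apply, Matrix.of_apply]
  exact sub_eq_sub_of_sum_sum_smul_eq h Z W

omit [DecidableEq Γ] [Fintype Γ'] [DecidableEq Γ'] in
/-- **Congruence of the antisymmetric part**: `T·of(A − Aᵀ)·Tᵀ = of((TATᵀ) − (TATᵀ)ᵀ)`. [cite: Salmhofer1999, App. B.2 (B.23)-(B.25)] -/
theorem mul_anti_mul_transpose (T : Matrix Γ' Γ R) (A : Matrix Γ Γ R) :
    T * (Matrix.of fun X Y => A X Y - A Y X) * Tᵀ =
      Matrix.of fun X Y => (T * A * Tᵀ) X Y - (T * A * Tᵀ) Y X := by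
  have hanti : (Matrix.of fun X Y => A X Y - A Y X) = A - Aᵀ := by
    ext X Y; rw [Matrix.of_apply, Matrix.sub_apply, Matrix.transpose_apply]
  have hanti' : (Matrix.of fun X Y => (T * A * Tᵀ) X Y - (T * A * Tᵀ) Y X) = T * A * Tᵀ - (T * A * Tᵀ)ᵀ := by
    ext X Y; rw [Matrix.of_apply, Matrix.sub_apply, Matrix.transpose_apply]
  rw [hanti, hanti', Matrix.mul_sub, Matrix.sub_mul, Matrix.transpose_mul, Matrix.transpose_mul, Matrix.transpose_transpose,
    Matrix.mul_assoc T Aᵀ Tᵀ]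

/-- **Transport of the antisymmetric matrix of a quadratic element**: if `map f (Σ A ψψ) = Σ B ψ̂ψ̂` then
`T·of(A − Aᵀ)·Tᵀ = of(B − Bᵀ)`, `T = toMatrix' f`. [cite: Salmhofer1999, App. B.2 (B.23)-(B.25)] -/
theorem mul_anti_mul_transpose_eq_of_map_eq (f : (Γ → R) →ₗ[R] (Γ' → R)) {A : Matrix Γ Γ R} {B : Matrix Γ' Γ' R}
    (h : ExteriorAlgebra.map f (∑ Y, ∑ Y', A Y Y' • (gen R Y * gen R Y')) = ∑ X, ∑ X', B X X' • (gen R X * gen R X')) :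
    LinearMap.toMatrix' f * (Matrix.of fun X Y => A X Y - A Y X) * (LinearMap.toMatrix' f)ᵀ =
      Matrix.of fun X Y => B X Y - B Y X := by
  rw [mul_anti_mul_transpose]
  rw [map_sum_sum_smul_gen_mul_gen] at h
  exact anti_eq_anti_of_sum_sum_smul_eq h

end Generic

/-! ### The grid counterterm matrix transported to the torus: `S_N S_g S_Nᵀ = S_K` -/

section Hubbard

variable {L M N : ℕ} [NeZero L]

/-- **Grid-to-torus transport of the counterterm matrix**: for EVERY matrix `N_g` on grid legs with
`−𝒩_{K,N} = Σ_{X,Y} N_g(X,Y) ψ(X)ψ(Y)`, the substitution `S_N = hubbardGridSub L M β N` (`2M ≤ N`, `β ≠ 0`) carries its antisymmetric part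
to that of the torus counterterm: `S_N·of(N_g − N_gᵀ)·S_Nᵀ = of(N_K − N_Kᵀ)`, `N_K((k,σ,ψ⁺),(k,σ,ψ⁻)) = −K(p_k)/(βL²)` the matrix of
`neg_counterQuadratic_eq_sum` (time-locality of `𝒩_K` on the grid, `map_hubbardGridSub_gridCounterQuadratic`).  With
`WeightedRowSumResolvent.transpose_mul_resolvent_mul_mul`: the grid covariance of the K-resummed torus covariance `M·C`
(`M(1 + C·of(N_K − N_Kᵀ)) = 1`) is the grid-dressed `M'·(S_Nᵀ C S_N)`. [cite: BenfattoGiulianiMastropietro2003, §1.2 The model (2.10)] -/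
theorem hubbardGridSub_mul_anti_mul_transpose [NeZero N] {β : ℝ} (hβ : β ≠ 0) (K : TrigPolyC4v) (hMN : 2 * M ≤ N)
    {Ng : Matrix (GridLeg (GridPoint L N)) (GridLeg (GridPoint L N)) ℂ}
    (hNg : -hubbardGridCounterQuadratic L N β K =
      ∑ X : GridLeg (GridPoint L N), ∑ Y : GridLeg (GridPoint L N), Ng X Y • (gen ℂ X * gen ℂ Y)) :
    hubbardGridSub L M β N * (Matrix.of fun X Y => Ng X Y - Ng Y X) * (hubbardGridSub L M β N)ᵀ =
      Matrix.of fun X Y : HubbardFieldIdx L M =>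
        (Matrix.of fun Z W : HubbardFieldIdx L M =>
            if Z.2 = 0 ∧ W = (Z.1, 1) then -(((K.eval (latticeMomentum L Z.1.1.2) / (β * (L : ℝ) ^ 2) : ℝ) : ℂ)) else 0) X Y -
          (Matrix.of fun Z W : HubbardFieldIdx L M =>
            if Z.2 = 0 ∧ W = (Z.1, 1) then -(((K.eval (latticeMomentum L Z.1.1.2) / (β * (L : ℝ) ^ 2) : ℝ) : ℂ)) else 0) Y X := by
  have hT : LinearMap.toMatrix' (Matrix.toLin' (hubbardGridSub L M β N)) = hubbardGridSub L M β N := LinearMap.toMatrix'_toLin' _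
  have hmap : ExteriorAlgebra.map (Matrix.toLin' (hubbardGridSub L M β N))
      (∑ X : GridLeg (GridPoint L N), ∑ Y : GridLeg (GridPoint L N), Ng X Y • (gen ℂ X * gen ℂ Y)) =
      ∑ X : HubbardFieldIdx L M, ∑ Y : HubbardFieldIdx L M,
        (Matrix.of fun Z W : HubbardFieldIdx L M =>
          if Z.2 = 0 ∧ W = (Z.1, 1) then -(((K.eval (latticeMomentum L Z.1.1.2) / (β * (L : ℝ) ^ 2) : ℝ) : ℂ)) else 0) X Y •
          (gen ℂ X * gen ℂ Y) := by
    rw [← hNg, map_neg, map_hubbardGridSub_gridCounterQuadratic hβ K hMN, neg_counterQuadratic_eq_sum]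
  have h := mul_anti_mul_transpose_eq_of_map_eq (Matrix.toLin' (hubbardGridSub L M β N)) hmap
  rwa [hT] at h

/-- **The grid counterterm matrix of `HubbardGridCounterQuadraticMatrix` transported to the torus**:
`S_N·of((−N_g) − (−N_g)ᵀ)·S_Nᵀ = of(N_K − N_Kᵀ)` for `N_g = gridCounterMatrix L N β K` (`−𝒩_{K,N} = Σ (−N_g) ψψ`,
`neg_hubbardGridCounterQuadratic_eq_sum_sum`). [cite: BenfattoGiulianiMastropietro2003, §1.2 The model (2.10)] -/
theorem hubbardGridSub_mul_gridCounterAnti_mul_transpose [NeZero N] {β : ℝ} (hβ : β ≠ 0) (K : TrigPolyC4v) (hMN : 2 * M ≤ N) :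
    hubbardGridSub L M β N *
        (Matrix.of fun X Y => (-gridCounterMatrix L N β K) X Y - (-gridCounterMatrix L N β K) Y X) * (hubbardGridSub L M β N)ᵀ =
      Matrix.of fun X Y : HubbardFieldIdx L M =>
        (Matrix.of fun Z W : HubbardFieldIdx L M =>
            if Z.2 = 0 ∧ W = (Z.1, 1) then -(((K.eval (latticeMomentum L Z.1.1.2) / (β * (L : ℝ) ^ 2) : ℝ) : ℂ)) else 0) X Y -
          (Matrix.of fun Z W : HubbardFieldIdx L M =>
            if Z.2 = 0 ∧ W = (Z.1, 1) then -(((K.eval (latticeMomentum L Z.1.1.2) / (β * (L : ℝ) ^ 2) : ℝ) : ℂ)) else 0) Y X :=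
  hubbardGridSub_mul_anti_mul_transpose hβ K hMN (neg_hubbardGridCounterQuadratic_eq_sum_sum β K)

end Hubbard

end Literature.MathematicalPhysics.QuantumLattice

end
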